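import Mathlib

/-!
# Gluing two families along a separating member preserves pencil independence

Helper file for crux `stmt-CriticalPhenomena-4575` (`NoHeavyLowerTail`, route `PercNearOneGluingNoHeavy`),
new-inequality factory seat `prim-ineq-gen-3` (gen 26).  Everything here is PROVED; no definitions.

Pencil row of a set `C`: `E ↦ [E ⊆ C] + t [E ∩ C = ∅]`; a *dependency* of a family `𝒜` on a column set `𝒞` is a functional `c`
with `∑_{C ∈ 𝒜} c C ([E ⊆ C] + t [E ∩ C = ∅]) = 0` for all `E ∈ 𝒞` (as in `…OrderedDifferencesOrderFilterMembership`).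
Say that a member `K` SEPARATES two sub-families `𝒜₁`, `𝒜₂` if `A ∩ B ⊆ K ⊆ A ∪ B` for all `A ∈ 𝒜₁`, `B ∈ 𝒜₂` (at `K`, the traces
`A \ K`, `B \ K` are disjoint and so are the co-traces `K \ A`, `K \ B`).  Then every member of `𝒜₂` has the same pencil entries as
`K` itself on every difference column of `insert K 𝒜₁` (`sdiff_subset_iff_of_separates`), so a dependency of the glued family
restricts to a dependency of `insert K 𝒜₁` after moving the total weight of `𝒜₂` onto `K` (`dep_sum_eq_of_separates`), and pencil
independence on the difference columns ((C0) of memo `CONJECTURE-ORD.md`) passes from the two parts to the glued family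
(`dep_eq_zero_of_separates`).  Consequence used in memo `CONJECTURE-STAR.md` §12: in a minimal counterexample to (C0) no member
separates the others ('local types are connected').
(prim-ineq-gen-3 gen 26, 2026-08-25.)
-/

namespace Summit.CriticalPhenomena.PercolationContinuityZ3.Theorems

namespace OrderedDifferences

open Finset
open scoped FinsetFamily

variable {α : Type*} [DecidableEq α] {K : Type*} [Field K]

/-- If `A ∩ B ⊆ S ⊆ A ∪ B` for every `A ∈ 𝒜₁`, then for any two members `A, A'` of `insert S 𝒜₁` the difference `A \ A'` is
contained in `B` iff it is contained in `S`, and is disjoint from `B` iff it is disjoint from `S`. -/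
theorem sdiff_subset_iff_of_separates (𝒜₁ : Finset (Finset α)) (S B : Finset α)
    (hB : ∀ A ∈ 𝒜₁, A ∩ B ⊆ S ∧ S ⊆ A ∪ B) (A A' : Finset α)
    (hA : A ∈ insert S 𝒜₁) (hA' : A' ∈ insert S 𝒜₁) :
    ((A \ A' ⊆ B ↔ A \ A' ⊆ S) ∧ (Disjoint (A \ A') B ↔ Disjoint (A \ A') S)) := by
  rw [mem_insert] at hA hA'
  refine ⟨⟨fun h => ?_, fun h => ?_⟩, ⟨fun h => ?_, fun h => ?_⟩⟩
  · -- `A \ A' ⊆ B ⟹ A \ A' ⊆ S`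
    rcases hA with rfl | hA
    · exact sdiff_subset
    · intro x hx
      exact (hB A hA).1 (mem_inter.mpr ⟨(mem_sdiff.mp hx).1, h hx⟩)
  · -- `A \ A' ⊆ S ⟹ A \ A' ⊆ B`
    rcases hA' with rfl | hA'
    · intro x hx
      exact absurd (h hx) (mem_sdiff.mp hx).2
    · intro x hx
      have hxS := h hx
      have hx2 := (hB A' hA').2 hxS
      rcases mem_union.mp hx2 with hxA' | hxB
      · exact absurd hxA' (mem_sdiff.mp hx).2
      · exact hxB
  · -- `Disjoint (A \ A') B ⟹ Disjoint (A \ A') S`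
    rcases hA' with rfl | hA'
    · exact disjoint_sdiff_self_left
    · rw [Finset.disjoint_left] at h ⊢
      intro x hx hxS
      rcases mem_union.mp ((hB A' hA').2 hxS) with hxA' | hxB
      · exact (mem_sdiff.mp hx).2 hxA'
      · exact h hx hxB
  · -- `Disjoint (A \ A') S ⟹ Disjoint (A \ A') B`
    rcases hA with rfl | hA
    · rw [Finset.disjoint_left] at h ⊢
      intro x hx hxB
      exact h hx (mem_sdiff.mp hx).1
    · rw [Finset.disjoint_left] at h ⊢
      intro x hx hxB
      exact h hx ((hB A hA).1 (mem_inter.mpr ⟨(mem_sdiff.mp hx).1, hxB⟩))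

/-- **Restriction of a dependency across a separating member.**  Let `S ∉ 𝒜₁ ∪ 𝒜₂`, `𝒜₁ ∩ 𝒜₂ = ∅`, and suppose `S` separates:
`A ∩ B ⊆ S ⊆ A ∪ B` for `A ∈ 𝒜₁`, `B ∈ 𝒜₂`.  Then on every difference column `E = A \ A'` of `insert S 𝒜₁` the pencil pairing of a
functional `c` over the glued family `insert S (𝒜₁ ∪ 𝒜₂)` equals the pairing over `insert S 𝒜₁` of the functional that agrees with
`c` on `𝒜₁` and carries the weight `c S + ∑_{B ∈ 𝒜₂} c B` at `S`. -/
theorem dep_sum_eq_of_separates (𝒜₁ 𝒜₂ : Finset (Finset α)) (S : Finset α)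
    (h1 : S ∉ 𝒜₁) (h2 : S ∉ 𝒜₂) (h12 : Disjoint 𝒜₁ 𝒜₂)
    (hsep : ∀ A ∈ 𝒜₁, ∀ B ∈ 𝒜₂, A ∩ B ⊆ S ∧ S ⊆ A ∪ B) (t : K) (c : Finset α → K)
    (A A' : Finset α) (hA : A ∈ insert S 𝒜₁) (hA' : A' ∈ insert S 𝒜₁) :
    ∑ C ∈ insert S (𝒜₁ ∪ 𝒜₂), c C * ((if A \ A' ⊆ C then (1 : K) else 0) +
        t * (if Disjoint (A \ A') C then (1 : K) else 0)) =
      (c S + ∑ B ∈ 𝒜₂, c B) * ((if A \ A' ⊆ S then (1 : K) else 0) +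
        t * (if Disjoint (A \ A') S then (1 : K) else 0)) +
      ∑ C ∈ 𝒜₁, c C * ((if A \ A' ⊆ C then (1 : K) else 0) +
        t * (if Disjoint (A \ A') C then (1 : K) else 0)) := by
  have hS : S ∉ 𝒜₁ ∪ 𝒜₂ := by
    rw [mem_union, not_or]; exact ⟨h1, h2⟩
  rw [sum_insert hS, sum_union h12]
  -- every `B ∈ 𝒜₂` has the same entries as `S`
  have hB : ∀ B ∈ 𝒜₂, c B * ((if A \ A' ⊆ B then (1 : K) else 0) +
      t * (if Disjoint (A \ A') B then (1 : K) else 0)) =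
      c B * ((if A \ A' ⊆ S then (1 : K) else 0) + t * (if Disjoint (A \ A') S then (1 : K) else 0)) := by
    intro B hBmem
    obtain ⟨hsub, hdis⟩ := sdiff_subset_iff_of_separates 𝒜₁ S B (fun A hA => hsep A hA B hBmem) A A' hA hA'
    simp only [hsub, hdis]
  rw [sum_congr rfl hB, ← sum_mul]
  ring

/-- **Gluing preserves pencil independence on the difference columns.**  With `S`, `𝒜₁`, `𝒜₂` as in
`dep_sum_eq_of_separates`: if every dependency of `insert S 𝒜₁` on its own difference columns vanishes, and likewise for
`insert S 𝒜₂`, then every dependency of the glued family `𝒜 = insert S (𝒜₁ ∪ 𝒜₂)` on its difference columns vanishes.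
Equivalently: in a minimal family carrying a non-zero dependency, no member separates the remaining members into two
cross-disjoint blocks. -/
theorem dep_eq_zero_of_separates (𝒜₁ 𝒜₂ : Finset (Finset α)) (S : Finset α)
    (h1 : S ∉ 𝒜₁) (h2 : S ∉ 𝒜₂) (h12 : Disjoint 𝒜₁ 𝒜₂)
    (hsep : ∀ A ∈ 𝒜₁, ∀ B ∈ 𝒜₂, A ∩ B ⊆ S ∧ S ⊆ A ∪ B) (t : K)
    (hC0₁ : ∀ c₁ : Finset α → K,
      (∀ E ∈ (insert S 𝒜₁) \\ (insert S 𝒜₁), ∑ C ∈ insert S 𝒜₁, c₁ C * ((if E ⊆ C then (1 : K) else 0) +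
        t * (if Disjoint E C then (1 : K) else 0)) = 0) → ∀ C ∈ insert S 𝒜₁, c₁ C = 0)
    (hC0₂ : ∀ c₂ : Finset α → K,
      (∀ E ∈ (insert S 𝒜₂) \\ (insert S 𝒜₂), ∑ C ∈ insert S 𝒜₂, c₂ C * ((if E ⊆ C then (1 : K) else 0) +
        t * (if Disjoint E C then (1 : K) else 0)) = 0) → ∀ C ∈ insert S 𝒜₂, c₂ C = 0)
    (c : Finset α → K)
    (hdep : ∀ E ∈ (insert S (𝒜₁ ∪ 𝒜₂)) \\ (insert S (𝒜₁ ∪ 𝒜₂)),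
      ∑ C ∈ insert S (𝒜₁ ∪ 𝒜₂), c C * ((if E ⊆ C then (1 : K) else 0) +
        t * (if Disjoint E C then (1 : K) else 0)) = 0) :
    ∀ C ∈ insert S (𝒜₁ ∪ 𝒜₂), c C = 0 := by
  -- the restricted functionals
  set c₁ : Finset α → K := fun C => if C = S then c S + ∑ B ∈ 𝒜₂, c B else c C with hc₁
  set c₂ : Finset α → K := fun C => if C = S then c S + ∑ B ∈ 𝒜₁, c B else c C with hc₂
  have hsep' : ∀ B ∈ 𝒜₂, ∀ A ∈ 𝒜₁, B ∩ A ⊆ S ∧ S ⊆ B ∪ A := by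
    intro B hB A hA
    obtain ⟨hi, hu⟩ := hsep A hA B hB
    exact ⟨by rwa [inter_comm], by rwa [union_comm]⟩
  -- `c₁` is a dependency of `insert S 𝒜₁`
  have hdep₁ : ∀ E ∈ (insert S 𝒜₁) \\ (insert S 𝒜₁), ∑ C ∈ insert S 𝒜₁, c₁ C *
      ((if E ⊆ C then (1 : K) else 0) + t * (if Disjoint E C then (1 : K) else 0)) = 0 := by
    intro E hE
    rw [mem_diffs] at hE
    obtain ⟨A, hA, A', hA', rfl⟩ := hE
    have key := dep_sum_eq_of_separates 𝒜₁ 𝒜₂ S h1 h2 h12 hsep t c A A' hA hA'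
    have hmem : A \ A' ∈ (insert S (𝒜₁ ∪ 𝒜₂)) \\ (insert S (𝒜₁ ∪ 𝒜₂)) := by
      rw [mem_diffs]
      refine ⟨A, ?_, A', ?_, rfl⟩
      · rcases mem_insert.mp hA with h | h
        · exact mem_insert.mpr (Or.inl h)
        · exact mem_insert.mpr (Or.inr (mem_union.mpr (Or.inl h)))
      · rcases mem_insert.mp hA' with h | h
        · exact mem_insert.mpr (Or.inl h)
        · exact mem_insert.mpr (Or.inr (mem_union.mpr (Or.inl h)))
    have h0 := hdep _ hmem
    rw [key] at h0
    rw [sum_insert h1]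
    have hS : c₁ S = c S + ∑ B ∈ 𝒜₂, c B := by simp [hc₁]
    have hrest : ∀ C ∈ 𝒜₁, c₁ C * ((if A \ A' ⊆ C then (1 : K) else 0) +
        t * (if Disjoint (A \ A') C then (1 : K) else 0)) =
        c C * ((if A \ A' ⊆ C then (1 : K) else 0) + t * (if Disjoint (A \ A') C then (1 : K) else 0)) := by
      intro C hC
      have hCS : C ≠ S := fun h => h1 (h ▸ hC)
      simp [hc₁, hCS]
    rw [hS, sum_congr rfl hrest]
    exact h0
  -- symmetric statement for `c₂`
  have hdep₂ : ∀ E ∈ (insert S 𝒜₂) \\ (insert S 𝒜₂), ∑ C ∈ insert S 𝒜₂, c₂ C *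
      ((if E ⊆ C then (1 : K) else 0) + t * (if Disjoint E C then (1 : K) else 0)) = 0 := by
    intro E hE
    rw [mem_diffs] at hE
    obtain ⟨A, hA, A', hA', rfl⟩ := hE
    have key := dep_sum_eq_of_separates 𝒜₂ 𝒜₁ S h2 h1 h12.symm hsep' t c A A' hA hA'
    have hmem : A \ A' ∈ (insert S (𝒜₁ ∪ 𝒜₂)) \\ (insert S (𝒜₁ ∪ 𝒜₂)) := by
      rw [mem_diffs]
      refine ⟨A, ?_, A', ?_, rfl⟩
      · rcases mem_insert.mp hA with h | h
        · exact mem_insert.mpr (Or.inl h)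
        · exact mem_insert.mpr (Or.inr (mem_union.mpr (Or.inr h)))
      · rcases mem_insert.mp hA' with h | h
        · exact mem_insert.mpr (Or.inl h)
        · exact mem_insert.mpr (Or.inr (mem_union.mpr (Or.inr h)))
    have h0 := hdep _ hmem
    rw [union_comm 𝒜₁ 𝒜₂] at h0
    rw [key] at h0
    rw [sum_insert h2]
    have hS : c₂ S = c S + ∑ B ∈ 𝒜₁, c B := by simp [hc₂]
    have hrest : ∀ C ∈ 𝒜₂, c₂ C * ((if A \ A' ⊆ C then (1 : K) else 0) +
        t * (if Disjoint (A \ A') C then (1 : K) else 0)) =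
        c C * ((if A \ A' ⊆ C then (1 : K) else 0) + t * (if Disjoint (A \ A') C then (1 : K) else 0)) := by
      intro C hC
      have hCS : C ≠ S := fun h => h2 (h ▸ hC)
      simp [hc₂, hCS]
    rw [hS, sum_congr rfl hrest]
    exact h0
  have hz₁ := hC0₁ c₁ hdep₁
  have hz₂ := hC0₂ c₂ hdep₂
  -- read off: c = 0 on 𝒜₁ and on 𝒜₂, and the two weights at S vanish
  have hA1 : ∀ C ∈ 𝒜₁, c C = 0 := by
    intro C hC
    have hCS : C ≠ S := fun h => h1 (h ▸ hC)
    have := hz₁ C (mem_insert_of_mem hC)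
    simpa [hc₁, hCS] using this
  have hA2 : ∀ C ∈ 𝒜₂, c C = 0 := by
    intro C hC
    have hCS : C ≠ S := fun h => h2 (h ▸ hC)
    have := hz₂ C (mem_insert_of_mem hC)
    simpa [hc₂, hCS] using this
  have hSval : c S = 0 := by
    have := hz₁ S (mem_insert_self S 𝒜₁)
    simp only [hc₁, if_true] at this
    rw [sum_eq_zero hA2, add_zero] at this
    exact this
  intro C hC
  rcases mem_insert.mp hC with rfl | hC
  · exact hSval
  · rcases mem_union.mp hC with h | h
    · exact hA1 C h
    · exact hA2 C h

end OrderedDifferences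

end Summit.CriticalPhenomena.PercolationContinuityZ3.Theorems
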